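import Summits.Schanuel.Schanuel.Theorems.ZilberEacGraphSurfaceComplete
import Literature.NumberTheory.Transcendental.PhilipponCriterionRank
import HarnessLib

/-!
# The dictionary lemma: a surface of Mantova–Masser's case whose base is the graph `x₁ = p(x₀)`
# IS a `W(p; P)` with `P` irreducible and torus fibres over infinitely many base points

HONEST FRAMING.  Cell `pub-schanuel` (Zilber's Exponential-Algebraic Closedness, case ladder;
host summit Schanuel), seat 2, gen 18 (HANDOFF O66).  The capstones of gens 16–18
(`unprojectedDensityQuestion_graphSurface_complete`, `…_of_uniqueTop`, …) take the surface in the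
form `W(p; P) = {x₁ = p(x₀), P(x₀; y₀, y₁) = 0}` together with the datum "`P(t; ·)` vanishes on
`(ℂˣ)²` for infinitely many `t`"; the sentence "every surface of the case over the graph is of this
form" was so far an informal dictionary remark (REFEREE R105).  This file proves it:
* `exists_eq_span_singleton_of_ringKrullDim_eq_two` — a prime `J ⊆ ℂ[X₀, X₁, X₂]` with
  `dim ℂ[X]/J = 2` is principal, generated by a prime element (UFD: a nonzero prime contains a
  prime element `f`; `(f) ⊆ J` are primes with quotients of the same finite dimension, hence equal);
* `exists_eq_graphSurface_of_subset_graph` — an irreducible closed `W ⊆ ℂ² × ℂ²` of dimension `2`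
  lying over the graph is `W(p; P)` for an irreducible `P` (push `I(W)` forward along the
  substitution `θ : x₀ ↦ t, x₁ ↦ p(t), yᵢ ↦ yᵢ`, whose kernel lies in `I(W)`);
* `forall_eq_eval_of_base_eq_graph` — if the Zariski closure of `π(W ∩ G²)` is the graph then `W`
  lies over the graph (`W ∩ G²` is Zariski dense in the irreducible `W`);
* `infinite_torusFibres_of_addProjDim_eq_one` — for `W = W(p; P)` with `dim cl π(W ∩ G²) = 1`
  the fibres `P(t; ·)` have torus zeros for infinitely many `t` (else `π(W ∩ G²)` is a point);
* **`exists_eq_graphSurface_of_mmCase`** and the LITERAL reading of the capstone,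
  **`unprojectedDense_of_mmCase_of_base_eq_graph`**: every `W` in Mantova–Masser's case
  (dim-π-S-1-free) whose base curve is the graph of a polynomial `p` with `deg p ≥ 1`,
  `Re(lc(p)·i^{deg p}) ≠ 0`, has Zariski-dense exponential points; and
  **`unprojectedDense_of_mmCase_of_base_eq_graph_of_not_cylinder`**: over graphs of degree `≥ 2`,
  every `W` of the case that is not a cylinder in the `y₁`-direction is dense (no leading-term
  condition).
NOT Schanuel's conjecture (neither used nor implied; EAC ⇏ SC); `EC(3,2)` stays OPEN; the density
question stays OPEN in general (PLMS 2024, §1 p. 5).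
-/

noncomputable section

open Complex MvPolynomial
open Literature.NumberTheory.Transcendental Literature.ModelTheory.Zilber
open Literature.ModelTheory.ExponentialFields

set_option linter.dupNamespace false

namespace Summit.Schanuel.Schanuel.Theorems

/-! ## Part A. Height-one primes of `ℂ[X₀, X₁, X₂]` are principal -/

/-- **A prime `J ⊆ ℂ[X₀, X₁, X₂]` with `dim ℂ[X]/J = 2` is generated by a prime element.**
[folklore] -/
theorem exists_eq_span_singleton_of_ringKrullDim_eq_two {J : Ideal (MvPolynomial (Fin 3) ℂ)}
    (hJ : J.IsPrime) (hdim : ringKrullDim (MvPolynomial (Fin 3) ℂ ⧸ J) = (2 : ℕ)) :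
    ∃ f : MvPolynomial (Fin 3) ℂ, Prime f ∧ J = Ideal.span {f} := by
  have hJ0 : J ≠ ⊥ := by
    rintro rfl
    rw [ringKrullDim_eq_of_ringEquiv (RingEquiv.quotientBot (MvPolynomial (Fin 3) ℂ)),
      MvPolynomial.ringKrullDim_of_isNoetherianRing, ringKrullDim_eq_zero_of_field ℂ,
      Nat.card_eq_fintype_card, Fintype.card_fin, zero_add] at hdim
    have h : ((3 : ℕ) : WithBot ℕ∞) = ((2 : ℕ) : WithBot ℕ∞) := hdim
    norm_num at h
  obtain ⟨f, hfJ, hf⟩ := hJ.exists_mem_prime_of_ne_bot hJ0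
  have hle : Ideal.span {f} ≤ J := (Ideal.span_singleton_le_iff_mem _).2 hfJ
  have hfprime : (Ideal.span {f}).IsPrime := (Ideal.span_singleton_prime hf.ne_zero).2 hf
  have hdimf : ringKrullDim (MvPolynomial (Fin 3) ℂ ⧸ Ideal.span {f}) = (2 : ℕ) :=
    Literature.RingTheory.KrullDimension.ringKrullDim_quotient_span_of_prime_mvPolynomial hf
  exact ⟨f, hf, (PhilipponMain.eq_of_le_of_ringKrullDim_quotient_eq hfprime hle hdimf hdim).symm⟩

/-! ## Part B. Irreducible surfaces over the graph are `W(p; P)` -/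

section Graph

variable (p : Polynomial ℂ)

/-- **An irreducible closed surface over the graph `x₁ = p(x₀)` is a `W(p; P)`** with `P`
irreducible. (new) -/
theorem exists_eq_graphSurface_of_subset_graph {W : Set (Fin 2 ⊕ Fin 2 → ℂ)}
    (hW : IsIrreducibleClosed ℂ W) (hdim : zariskiDim ℂ W = (2 : ℕ))
    (hπ : ∀ w ∈ W, w (Sum.inl 1) = p.eval (w (Sum.inl 0))) :
    ∃ P : MvPolynomial (Fin 3) ℂ, Irreducible P ∧
      W = {w : Fin 2 ⊕ Fin 2 → ℂ | w (Sum.inl 1) = p.eval (w (Sum.inl 0)) ∧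
        MvPolynomial.eval ![w (Sum.inl 0), w (Sum.inr 0), w (Sum.inr 1)] P = 0} := by
  set θ : MvPolynomial (Fin 2 ⊕ Fin 2) ℂ →ₐ[ℂ] MvPolynomial (Fin 3) ℂ :=
    aeval (Sum.elim ![MvPolynomial.X 0, Polynomial.aeval (MvPolynomial.X 0 : MvPolynomial (Fin 3) ℂ) p]
      (fun i => MvPolynomial.X (Fin.succ i)) : Fin 2 ⊕ Fin 2 → MvPolynomial (Fin 3) ℂ) with hθ_def
  set I : Ideal (MvPolynomial (Fin 2 ⊕ Fin 2) ℂ) := vanishingIdeal ℂ W with hI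
  haveI hIprime : I.IsPrime := hW.2
  have hθ : Function.Surjective θ := graphCurveSubst_surjective p
  -- the kernel of `θ` vanishes on `W`
  have hker : RingHom.ker θ ≤ I := by
    intro g hg
    rw [RingHom.mem_ker] at hg
    rw [hI, mem_vanishingIdeal_iff]
    intro w hw
    rw [← eval_lcPt_aeval_graphCurveSubst p (hπ w hw) g]
    change MvPolynomial.eval (lcPt w) (θ g) = 0
    rw [hg, map_zero]
  set J : Ideal (MvPolynomial (Fin 3) ℂ) := Ideal.map θ I with hJ
  have hJprime : J.IsPrime := Ideal.map_isPrime_of_surjective hθ hker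
  have hcomap : Ideal.comap θ J = I := by
    rw [hJ, Ideal.comap_map_of_surjective _ hθ]
    exact sup_eq_left.2 hker
  -- `ℂ[x, y] / I ≅ ℂ[t, y] / J`
  let g : MvPolynomial (Fin 2 ⊕ Fin 2) ℂ →ₐ[ℂ] (MvPolynomial (Fin 3) ℂ ⧸ J) :=
    (Ideal.Quotient.mkₐ ℂ J).comp θ
  have hg : Function.Surjective g := (Ideal.Quotient.mkₐ_surjective ℂ J).comp hθ
  have hkerg : RingHom.ker g = I := by
    rw [← hcomap]
    ext q
    simp only [RingHom.mem_ker, Ideal.mem_comap, g, AlgHom.comp_apply, Ideal.Quotient.mkₐ_eq_mk,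
      Ideal.Quotient.eq_zero_iff_mem]
  have hdimJ : ringKrullDim (MvPolynomial (Fin 3) ℂ ⧸ J) = (2 : ℕ) := by
    rw [← ringKrullDim_eq_of_ringEquiv (Ideal.quotientKerAlgEquivOfSurjective hg).toRingEquiv,
      hkerg]
    exact hdim
  obtain ⟨f, hf, hJf⟩ := exists_eq_span_singleton_of_ringKrullDim_eq_two hJprime hdimJ
  refine ⟨f, hf.irreducible, ?_⟩
  rw [graphSurface_eq_zeroLocus, ← hθ_def, ← hJf, hcomap, hI]
  exact eq_zeroLocus_vanishingIdeal_of_isZariskiClosed hW.1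

/-- **If the Zariski closure of `π(W ∩ G²)` is the graph, `W` lies over the graph** (`W ∩ G²` is
Zariski dense in the irreducible `W`). (new) -/
theorem forall_eq_eval_of_base_eq_graph {W : Set (Fin 2 ⊕ Fin 2 → ℂ)} (hW : IsIrreducibleClosed ℂ W)
    (hne : (W ∩ torusLocus ℂ 2).Nonempty)
    (hbase : zeroLocus ℂ (vanishingIdeal ℂ (projAdd '' (W ∩ torusLocus ℂ 2))) =
      {x : Fin 2 → ℂ | x 1 = p.eval (x 0)}) :
    ∀ w ∈ W, w (Sum.inl 1) = p.eval (w (Sum.inl 0)) := by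
  set B : MvPolynomial (Fin 2) ℂ := MvPolynomial.X 1 -
    Polynomial.aeval (MvPolynomial.X 0 : MvPolynomial (Fin 2) ℂ) p with hB
  have hBeval : ∀ x : Fin 2 → ℂ, aeval x B = x 1 - p.eval (x 0) := by
    intro x
    rw [hB, map_sub, MvPolynomial.aeval_X, ← Polynomial.aeval_algHom_apply, MvPolynomial.aeval_X,
      Polynomial.coe_aeval_eq_eval]
  -- `B` vanishes on the graph `= Z(I(π V)) ⊇ π V`
  have hBmem : B ∈ vanishingIdeal ℂ (projAdd '' (W ∩ torusLocus ℂ 2)) := by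
    rw [mem_vanishingIdeal_iff]
    intro x hx
    have hx' : x ∈ zeroLocus ℂ (vanishingIdeal ℂ (projAdd '' (W ∩ torusLocus ℂ 2))) :=
      zeroLocus_vanishingIdeal_le _ hx
    rw [hbase] at hx'
    rw [hBeval, hx', sub_self]
  rw [vanishingIdeal_image_projAdd, vanishingIdeal_inter_torusLocus hW hne, Ideal.mem_comap,
    mem_vanishingIdeal_iff] at hBmem
  intro w hw
  have h := hBmem w hw
  rw [aeval_rename] at h
  have e : aeval (w ∘ Sum.inl) B = w (Sum.inl 1) - p.eval (w (Sum.inl 0)) := hBeval _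
  rw [e, sub_eq_zero] at h
  exact h

variable {p}

/-- A point has Zariski dimension `0` (its vanishing ideal is maximal). [folklore] -/
theorem zariskiDim_singleton_fin (x : Fin 2 → ℂ) : zariskiDim ℂ ({x} : Set (Fin 2 → ℂ)) = 0 := by
  have hmax : (vanishingIdeal ℂ ({x} : Set (Fin 2 → ℂ))).IsMaximal :=
    isMaximal_iff_eq_vanishingIdeal_singleton.2 ⟨x, rfl⟩
  unfold zariskiDim
  exact ringKrullDim_eq_zero_of_isField
    ((Ideal.Quotient.maximal_ideal_iff_isField_quotient _).1 hmax)

/-- **Torus fibres over infinitely many base points** for an irreducible `W(p; P)` with non-empty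
torus part and `dim cl π(W ∩ G²) = 1` (else `π(W ∩ G²)` is a single point, of dimension `0`).
(new) -/
theorem infinite_torusFibres_of_addProjDim_eq_one {P : MvPolynomial (Fin 3) ℂ}
    (hW : IsIrreducibleClosed ℂ {w : Fin 2 ⊕ Fin 2 → ℂ | w (Sum.inl 1) = p.eval (w (Sum.inl 0)) ∧
      MvPolynomial.eval ![w (Sum.inl 0), w (Sum.inr 0), w (Sum.inr 1)] P = 0})
    (hne : ({w : Fin 2 ⊕ Fin 2 → ℂ | w (Sum.inl 1) = p.eval (w (Sum.inl 0)) ∧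
      MvPolynomial.eval ![w (Sum.inl 0), w (Sum.inr 0), w (Sum.inr 1)] P = 0} ∩
      torusLocus ℂ 2).Nonempty)
    (h1 : addProjDim ℂ 2 {w : Fin 2 ⊕ Fin 2 → ℂ | w (Sum.inl 1) = p.eval (w (Sum.inl 0)) ∧
      MvPolynomial.eval ![w (Sum.inl 0), w (Sum.inr 0), w (Sum.inr 1)] P = 0} = (1 : ℕ)) :
    Set.Infinite {t : ℂ | ∃ c : Fin 2 → ℂ, c 0 ≠ 0 ∧ c 1 ≠ 0 ∧
      MvPolynomial.eval ![t, c 0, c 1] P = 0} := by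
  classical
  intro hfin
  set W := {w : Fin 2 ⊕ Fin 2 → ℂ | w (Sum.inl 1) = p.eval (w (Sum.inl 0)) ∧
      MvPolynomial.eval ![w (Sum.inl 0), w (Sum.inr 0), w (Sum.inr 1)] P = 0} with hWdef
  set V := projAdd '' (W ∩ torusLocus ℂ 2) with hV
  set T := hfin.toFinset with hT
  -- every torus point of `W` has its base coordinate `x₀` in `T`
  have hmemT : ∀ x ∈ V, x 0 ∈ T := by
    rintro _ ⟨w, ⟨hw, hwt⟩, rfl⟩
    rw [hT, Set.Finite.mem_toFinset]
    refine ⟨![w (Sum.inr 0), w (Sum.inr 1)], ?_, ?_, ?_⟩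
    · simpa using (mem_torusLocus_iff.1 hwt) 0
    · simpa using (mem_torusLocus_iff.1 hwt) 1
    · simpa [projAdd] using hw.2
  -- `∏_{t ∈ T} (X₀ - t)` vanishes on `V`; the vanishing ideal of `V` is prime, so one factor does
  set 𝔮 : Ideal (MvPolynomial (Fin 2) ℂ) := vanishingIdeal ℂ V with h𝔮
  haveI h𝔮prime : 𝔮.IsPrime := isPrime_vanishingIdeal_projAdd hW hne
  have hprod : (∏ t ∈ T, (MvPolynomial.X 0 - MvPolynomial.C t : MvPolynomial (Fin 2) ℂ)) ∈ 𝔮 := by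
    rw [h𝔮, mem_vanishingIdeal_iff]
    intro x hx
    rw [map_prod]
    exact Finset.prod_eq_zero (hmemT x hx) (by simp)
  obtain ⟨t₀, -, ht₀⟩ := (Ideal.IsPrime.prod_mem_iff.1 hprod)
  -- hence `V ⊆ {(t₀, p(t₀))}`
  have hsub : V ⊆ {(![t₀, p.eval t₀] : Fin 2 → ℂ)} := by
    intro x hx
    have hx0 : x 0 = t₀ := by
      rw [h𝔮, mem_vanishingIdeal_iff] at ht₀
      have := ht₀ x hx
      rw [map_sub, MvPolynomial.aeval_X, MvPolynomial.aeval_C, sub_eq_zero] at this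
      exact this
    obtain ⟨w, ⟨hw, -⟩, rfl⟩ := hx
    rw [Set.mem_singleton_iff]
    funext i
    fin_cases i
    · simpa [projAdd] using hx0
    · have e : w (Sum.inl 0) = t₀ := by simpa [projAdd] using hx0
      simpa [projAdd, e] using hw.1
  -- and a point has dimension `0 < 1`
  have hle := zariskiDim_mono (K := ℂ) hsub
  unfold addProjDim at h1
  rw [← hV] at h1
  rw [h1, zariskiDim_singleton_fin] at hle
  exact absurd hle (by norm_num)

end Graph

/-! ## Part C. From Mantova–Masser's case to `W(p; P)`, and the literal capstone -/

section MMCase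

variable (p : Polynomial ℂ)

/-- **The dictionary lemma.**  A `W` in Mantova–Masser's case (dim-π-S-1-free) whose base curve
(the Zariski closure of `π(W ∩ G²)`) is the graph `x₁ = p(x₀)` is `W(p; P)` for some irreducible
`P ∈ ℂ[x, y₀, y₁]` such that `P(t; ·)` vanishes somewhere on `(ℂˣ)²` for infinitely many `t`.
(new) -/
theorem exists_eq_graphSurface_of_mmCase {W : Set (Fin 2 ⊕ Fin 2 → ℂ)} (hmm : MMCaseDimPiOneFree W)
    (hbase : zeroLocus ℂ (vanishingIdeal ℂ (projAdd '' (W ∩ torusLocus ℂ 2))) =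
      {x : Fin 2 → ℂ | x 1 = p.eval (x 0)}) :
    ∃ P : MvPolynomial (Fin 3) ℂ, Irreducible P ∧
      Set.Infinite {t : ℂ | ∃ c : Fin 2 → ℂ, c 0 ≠ 0 ∧ c 1 ≠ 0 ∧
        MvPolynomial.eval ![t, c 0, c 1] P = 0} ∧
      W = {w : Fin 2 ⊕ Fin 2 → ℂ | w (Sum.inl 1) = p.eval (w (Sum.inl 0)) ∧
        MvPolynomial.eval ![w (Sum.inl 0), w (Sum.inr 0), w (Sum.inr 1)] P = 0} := by
  obtain ⟨hW, hne, hdim, h1, -⟩ := hmm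
  have hπ := forall_eq_eval_of_base_eq_graph p hW hne hbase
  obtain ⟨P, hP, hWP⟩ := exists_eq_graphSurface_of_subset_graph p hW hdim hπ
  refine ⟨P, hP, ?_, hWP⟩
  subst hWP
  exact infinite_torusFibres_of_addProjDim_eq_one hW hne h1

/-- **The literal capstone.**  Every `W ⊆ ℂ² × ℂ²` in Mantova–Masser's case (dim-π-S-1-free) whose
base curve is the graph `x₁ = p(x₀)` of a polynomial with `deg p ≥ 1` and
`Re(lc(p)·i^{deg p}) ≠ 0` has Zariski-dense exponential points (`I(W ∩ Γ_exp) = I(W)`).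
[cite: MantovaMasser2023, §1 Further remarks, p. 5 (the question, open in general)] (new) -/
theorem unprojectedDense_of_mmCase_of_base_eq_graph (hd : 1 ≤ p.natDegree)
    (hre : (p.leadingCoeff * I ^ p.natDegree).re ≠ 0) {W : Set (Fin 2 ⊕ Fin 2 → ℂ)}
    (hmm : MMCaseDimPiOneFree W)
    (hbase : zeroLocus ℂ (vanishingIdeal ℂ (projAdd '' (W ∩ torusLocus ℂ 2))) =
      {x : Fin 2 → ℂ | x 1 = p.eval (x 0)}) :
    UnprojectedDense W := by
  obtain ⟨P, hP, hfib, rfl⟩ := exists_eq_graphSurface_of_mmCase p hmm hbase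
  exact unprojectedDense_graphSurface_complete p hd hre hP hfib

/-- **Over graphs of degree `≥ 2`: every `W` of the case which is not a cylinder in the
`y₁`-direction is dense** (no leading-term condition).  If some point of `W` leaves `W` when its
`y₁`-coordinate is changed, the fibre polynomial produced by the dictionary lemma involves `y₁`,
and `unprojectedDensityQuestion_graphSurface_of_y1` applies.
[cite: MantovaMasser2023, §1 Further remarks, p. 5 (the question, open in general)] (new) -/
theorem unprojectedDense_of_mmCase_of_base_eq_graph_of_not_cylinder (hd : 2 ≤ p.natDegree)
    {W : Set (Fin 2 ⊕ Fin 2 → ℂ)} (hmm : MMCaseDimPiOneFree W)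
    (hbase : zeroLocus ℂ (vanishingIdeal ℂ (projAdd '' (W ∩ torusLocus ℂ 2))) =
      {x : Fin 2 → ℂ | x 1 = p.eval (x 0)})
    (hy : ∃ w ∈ W, ∃ c : ℂ, Function.update w (Sum.inr 1) c ∉ W) :
    UnprojectedDense W := by
  obtain ⟨P, hP, hfib, hWP⟩ := exists_eq_graphSurface_of_mmCase p hmm hbase
  have hm : ∃ m ∈ P.support, m 2 ≠ 0 := by
    by_contra hall
    push Not at hall
    obtain ⟨P₂, rfl⟩ := exists_rename_castSucc_eq hall
    obtain ⟨w, hw, c, hwc⟩ := hy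
    apply hwc
    rw [hWP] at hw ⊢
    obtain ⟨hw1, hw2⟩ := hw
    refine ⟨?_, ?_⟩
    · simp only [ne_eq, reduceCtorEq, not_false_eq_true, Function.update_of_ne]
      simpa using hw1
    · rw [eval_vec3_rename_castSucc] at hw2 ⊢
      simpa [Function.update_of_ne] using hw2
  rw [hWP]
  exact (unprojectedDensityQuestion_graphSurface_of_y1 p hd hP hm hfib).2

end MMCase

end Summit.Schanuel.Schanuel.Theorems
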